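import Literature.Computability.Cryptography.CsidhActionTransitiveProofs
import Literature.AlgebraicGeometry.Motives.FaltingsECCardFrontierProofs
import HarnessLib

/-!
# The CSIDH class-group action theorem: the exact remaining input

Sibling *proofs* file (theorems only, D-0014/D-0026) of
`Literature.Computability.Cryptography.CsidhAction`. The named fact `csidh_classGroupAction`
(Castryck–Lange–Martindale–Panny–Renes, *CSIDH*, ASIACRYPT 2018, §3 Thm. 7 with Lemma 6 and §5
Prop. 8, after Waterhouse 1969 Thm. 4.5 / Schoof 1987 Thm. 4.5) is a theorem of the tree except for
the existence of an `𝔽_p`-isogeny between any two valid curves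
(`csidh_classGroupAction_of_isogenous`, `CsidhActionTransitiveProofs`), which the paper takes from
Tate's isogeny theorem ("these are the curves with `p + 1` points", §4; the tree's named fact
`Literature.AlgebraicGeometry.Motives.isIsogenous_iff_card_point_eq`,
`csidh_classGroupAction_of_isIsogenous_iff_card`). The tree proves that named fact from exactly
one statement of the theory of abelian varieties over a finite field
(`Motives/FaltingsECCardFrontierProofs`, Part 5): the finiteness of `K`-isomorphism classes of
abelian varieties of each dimension over the finite field `K`
(`AbelianVariety.finite_isoClasses_of_finite K g`, Milne 1986 Cor. 18.9), of which Tate's lattice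
argument consumes only (∞-iso) — in every sequence of abelian varieties over `K` isogenous to a
given one, infinitely many terms are mutually isomorphic. This file records the two compositions,
so that `csidh_classGroupAction_holds` is one line from either `_holds` theorem once it lands:

* `csidh_classGroupAction_of_finite_isoClasses` — `csidh_classGroupAction` from
  `finite_isoClasses_of_finite (ZMod p) g` for the primes `p ≡ 3 (mod 8)`, `p ≥ 5`, and all `g`;
* `csidh_classGroupAction_of_exists_infinite_iso` — `csidh_classGroupAction` from (∞-iso) over
  those prime fields.

No definition and no named fact is introduced (D-0026); theorems only, one-line compositions.

## References

* [CastryckEtAl2018] W. Castryck, T. Lange, C. Martindale, L. Panny, J. Renes, *CSIDH: an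
  efficient post-quantum commutative group action*, ASIACRYPT 2018, §3 Thm. 7, §4, §5 Prop. 8.
* [Waterhouse1969] W. C. Waterhouse, *Abelian varieties over finite fields*, Ann. Sci. ÉNS (4) 2
  (1969), Thm. 4.2 and Thm. 4.5.
* [Tate1966Endomorphisms] J. Tate, *Endomorphisms of abelian varieties over finite fields*,
  Invent. Math. 2 (1966), §3 Thm. 1.
* [Milne1986AbelianVarieties] J. S. Milne, *Abelian Varieties*, in Cornell–Silverman (1986),
  Cor. 18.9.
-/

noncomputable section

namespace Literature.Computability.Cryptography.Csidh

open Literature.AlgebraicGeometry.Motives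

/-- **`csidh_classGroupAction` from the finiteness of isomorphism classes of abelian varieties over
the prime fields `𝔽_p`, `p ≡ 3 (mod 8)`, `p ≥ 5`** (Milne 1986, Cor. 18.9, the tree's named fact
`AbelianVariety.finite_isoClasses_of_finite (ZMod p) g`, all `g`): Tate's isogeny theorem in
point-count form over `𝔽_p` follows from it
(`isIsogenous_iff_card_point_eq_of_finite_isoClasses`, `Motives/FaltingsECCardFrontierProofs`),
two valid curves both have `p + 1` points, and `csidh_classGroupAction_of_isogenous` (clauses (1),
(2), freeness, and transitivity along any `𝔽_p`-isogeny) concludes.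
[cite: CastryckEtAl2018, §3 Thm. 7 and §4] [cite: Tate1966Endomorphisms, Thm. 1] -/
theorem csidh_classGroupAction_of_finite_isoClasses
    (hfin : ∀ (p : ℕ) [Fact p.Prime], p % 8 = 3 → 5 ≤ p →
      ∀ g : ℕ, AbelianVariety.finite_isoClasses_of_finite (ZMod p) g) :
    csidh_classGroupAction :=
  csidh_classGroupAction_of_isogenous fun p _ hp8 hp5 A₀ A₁ h₀ h₁ ↦ by
    haveI := isElliptic_of_isCoeff hp8 h₀
    haveI := isElliptic_of_isCoeff hp8 h₁
    exact (isIsogenous_iff_card_point_eq_of_finite_isoClasses (curve p A₀) (curve p A₁)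
      (hfin p hp8 hp5)).2 (by rw [h₀.2, h₁.2])

/-- **`csidh_classGroupAction` from (∞-iso) over the prime fields `𝔽_p`, `p ≡ 3 (mod 8)`,
`p ≥ 5`** — the hypothesis Tate's lattice argument actually consumes (Tate 1966, §2; Milne,
*Abelian Varieties* (2008), Ch. IV, Lemma 2.4): if in every sequence of abelian varieties over
`𝔽_p` isogenous to a given one infinitely many terms are mutually isomorphic, then Tate's isogeny
theorem in point-count form holds over `𝔽_p`
(`isIsogenous_iff_card_point_eq_of_exists_infinite_iso`, `Motives/FaltingsECCardFrontierProofs`),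
and `csidh_classGroupAction_of_isogenous` concludes as above.
[cite: CastryckEtAl2018, §3 Thm. 7 and §4] [cite: Tate1966Endomorphisms, Thm. 1] -/
theorem csidh_classGroupAction_of_exists_infinite_iso
    (hiso : ∀ (p : ℕ) [Fact p.Prime], p % 8 = 3 → 5 ≤ p →
      ∀ (P : AbelianVariety (ZMod p)) (C : ℕ → AbelianVariety (ZMod p)),
        (∀ n, AbelianVariety.IsIsogenous (C n) P) →
          ∃ S : Set ℕ, S.Infinite ∧ ∀ m ∈ S, ∀ n ∈ S, Nonempty (C m ≅ C n)) :
    csidh_classGroupAction :=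
  csidh_classGroupAction_of_isogenous fun p _ hp8 hp5 A₀ A₁ h₀ h₁ ↦ by
    haveI := isElliptic_of_isCoeff hp8 h₀
    haveI := isElliptic_of_isCoeff hp8 h₁
    exact (isIsogenous_iff_card_point_eq_of_exists_infinite_iso (curve p A₀) (curve p A₁)
      (fun P C hC ↦ hiso p hp8 hp5 P C hC)).2 (by rw [h₀.2, h₁.2])

end Literature.Computability.Cryptography.Csidh
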